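import Summits.Langlands.Langlands.Theorems.QuadraticWindowHostInducedRepMemberSign
import Summits.Langlands.Langlands.Theorems.QuadraticWindowHostInducedRepPaneDefsCont
/-!
# The sign step in continuation form — `stub_memberSign_cont` (wave 4 of line `one-transparent-pane`,
# crux `Summit.Langlands.Langlands.Theses.QuadraticWindow.HostInducedRep`, item stmt-Langlands-10902)

LOG (wave-4 worker B, 2026-08-16).  `stub_memberSign_cont`: VERBATIM the landed `stub_memberSign`
(`…MemberSign.lean`) with the Asai-sign currency changed from raw Euler-product poles (`HasAsaiSign`,
`AsaiSign.lean`) to continued-`L`-function poles (`HasAsaiSignCont`, `AsaiSignCont.lean`) in the three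
hypotheses `hex` (= HEX_CONT), `hpin` (= PIN_CONT), `hpane` (= PANE_CONT, the conclusion of
`stub_paneLaw_cont`) and in the conclusion (`MemberPkgCont`, `…PaneDefsCont.lean`).  The proof is the
landed one, unchanged but for the currency of the single line `hAsai`; every helper lemma is imported from
`…MemberSign.lean` (§§1–4 there).

Statement.  Hypotheses (inline): existence of continuation-form Asai signs (`hex`), the sign pin (`hpin`),
the pane law (`hpane`); the crux data with `Hyps`, `F` not totally real; a CM quadratic `K/F₀` (involution
`cK`); a pane tower `L ⊃ F, K` with involution `s` (`IsPaneTower`); `θ` with `ParityOut F K θ`; and for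
every admissible `μ` (`MuHyp`) member objects `τ', ψ₁, P, T, χ` with `SatakeOut`, `ArchOut`, `PaneArchOut`
for `χ₀ = θ⁻¹ μ`.  Conclusion: `MemberPkgCont`.

Proof (pure logic, as in `…MemberSign.lean`).  (A) For `μ = 1` a sign `κ` of `P` exists; at every
embedding `σ` of `L` complex on `F` (a pane: `IsConj σ s`) the pin with `r = (n-1)/2 + (m_σ+k)/2` and the
coset clause give `(-1)^{m_σ+k} = κ` (`neg_one_zpow_eq_of_pin`), so `θ_v(-1)` is constant on the
complex-type real places of `F₀`.  (B) `ParityOut`: constant below the real places of `F`; every real place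
is of one type (`exists_isReal_of_not_cx`); switch `ε₀, c ∈ {±1}`.  (C) `μ ∈ {1, μK, μF, μK μF}` (signs
`1`, `-1`, `-1` exactly on the complex type) achieves `(θ⁻¹μ)_v(-1) = (-1)^{n+k}` everywhere.  (D) `ArchOut`
gives `C`-algebraicity and algebraicity of `ψ₁`; (E) at one pane (exists: `F` is not totally real)
`PaneArchOut` gives exponents in `½ + ℤ` (`exists_int_add_half_of_neg_one_zpow`) and the pane law at the
base `K⁺ = maximalRealSubfield K` (`complexConj K = cK`, `complexConj_apply_eq`; transport of
`IsConjSelfDualAE`) gives `HasAsaiSignCont (complexConj K) 1`.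
-/

open scoped BigOperators Polynomial Classical NumberField Topology
open Filter Polynomial IsDedekindDomain NumberField
open Literature.NumberTheory.Automorphic Literature.NumberTheory.GaloisRepresentations
open Summit.Langlands.Langlands.Theorems.HostInducedRep.GrsExplicitDescent

-- `Summit.Langlands.Langlands.…` (summit = sub-problem name, D-0017 layout) trips `dupNamespace`.
set_option linter.dupNamespace false

noncomputable section

namespace Summit.Langlands.Langlands.Theorems.HostInducedRep.OneTransparentPane

section Main

/-- **Sub-stub SIGN in continuation form (`stub_memberSign_cont`)** — the sign law of the line in typed
form, continuation-form currency: from `hex` (HEX_CONT), `hpin` (PIN_CONT), `hpane` (PANE_CONT), the parity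
output and the member outputs for every admissible `μ`, the member statement `MemberPkgCont` (type I
everywhere, standard Asai sign `HasAsaiSignCont (complexConj K) 1`); proof in the module docstring
(verbatim the landed `stub_memberSign`). [folklore] -/
theorem stub_memberSign_cont : (∀ (F E : Type) [Field F] [NumberField F] [Field E] [NumberField E] [Algebra F E] (c : E ≃ₐ[F] E), Module.finrank F E = 2 → c ≠ 1 → ∀ (N : ℕ) (hcpt : isCompact_glFiniteIntegralLevel N E) (P : CuspidalAutomorphicRepData N E hcpt), 0 < N → P.1.IsConjSelfDualAE c → ∃ κ : ℤˣ, P.1.HasAsaiSignCont c κ) → (∀ (F E : Type) [Field F] [NumberField F] [Field E] [NumberField E] [Algebra F E] (c : E ≃ₐ[F] E), Module.finrank F E = 2 → c ≠ 1 → ∀ (N : ℕ) (hcpt : isCompact_glFiniteIntegralLevel N E) (P : CuspidalAutomorphicRepData N E hcpt) (κ : ℤˣ) (χ : (E →+* ℂ) → Multiset ℂ) (σ : E →+* ℂ) (r : ℝ), 0 < N → P.1.IsConjSelfDualAE c → P.1.HasAsaiSignCont c κ → P.1.HasArchParameter χ → NumberField.ComplexEmbedding.IsConj σ c → (χ σ).Nodup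 → (∀ a ∈ χ σ, ∃ m : ℤ, a = (m : ℂ) + (r : ℂ)) → ∀ a ∈ χ σ, ∃ m : ℤ, a = (m : ℂ) + ((N : ℂ) - 1) / 2 + (1 - ((κ : ℤ) : ℂ)) / 4) → (∀ (F₀ K F' L : Type) [Field F₀] [NumberField F₀] [Field K] [NumberField K] [Field F'] [NumberField F'] [Field L] [NumberField L] [Algebra F₀ K] [Algebra K L] [Algebra F' L] (cK : K ≃ₐ[F₀] K) (s : L ≃ₐ[F'] L), Module.finrank F₀ K = 2 → Module.finrank K L = 2 → Module.finrank F' L = 2 → cK ≠ 1 → s ≠ 1 → (∀ x : K, s (algebraMap K L x) = algebraMap K L (cK x)) → ∀ (n : ℕ) (hL : isCompact_glFiniteIntegralLevel n L) (hK : isCompact_glFiniteIntegralLevel (2 * n) K) (P : CuspidalAutomorphicRepData n L hL) (Q : CuspidalAutomorphicRepData (2 * n) K hK) (χ : (L →+* ℂ) → Multiset ℂ) (σ : L →+* ℂ), 0 < n → IsAutomorphicInductionAlong P.1 Q.1 → P.1.IsConjSelfDualAE s → Q.1.IsConjSelfDualAE cK → P.1.HasArchParameter χ → NumberField.ComplexEmbedding.IsConj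 σ s → (χ σ).Nodup → Multiset.card (χ σ) = n → (∀ a ∈ χ σ, ∃ m : ℤ, a = (m : ℂ) + 1 / 2) → Q.1.HasAsaiSignCont cK 1) → ∀ (F₀ F : Type) [Field F₀] [NumberField F₀] [Field F] [NumberField F] [Algebra F₀ F] (τ : F ≃ₐ[F₀] F) (n : ℕ) (hcpt : isCompact_glFiniteIntegralLevel n F) (π : CuspidalAutomorphicRepData n F hcpt) (e : FramedGaloisRep F₀ ℂ 1) (k : ℤ) (ℓ : ℕ) [Fact ℓ.Prime] (ι : PadicAlgCl ℓ ≃+* ℂ) (eψ : FramedGaloisRep F ℂ 1), Hyps τ n π e k ℓ eψ → ¬ IsTotallyReal F → ∀ (K : Type) [Field K] [NumberField K] [Algebra F₀ K] [IsCMField K] (cK : K ≃ₐ[F₀] K), Module.finrank F₀ K = 2 → cK ≠ 1 → ∀ (L F' : Type) [Field L] [NumberField L] [Field F'] [NumberField F'] [Algebra F₀ L] [Algebra F L] [Algebra K L] [Algebra F' L] [IsScalarTower F₀ F L] [IsScalarTower F₀ K L] [IsGalois K L] (s : L ≃ₐ[F'] L), IsPaneTower τ cK L F' s → ∀ (θ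 : HeckeCharacter F₀), ParityOut F K θ → (∀ μ : HeckeCharacter F₀, MuHyp F K μ → ∃ (τ' : CuspidalAutomorphicRepData (2 * n) K (isCompact_glFiniteIntegralLevel_holds (2 * n) K)) (ψ₁ : HeckeCharacter K) (P : CuspidalAutomorphicRepData n L (isCompact_glFiniteIntegralLevel_holds n L)) (T : InfinityType K (2 * n)) (χ : (L →+* ℂ) → Multiset ℂ), SatakeOut F₀ π ι eψ cK s τ'.1 ψ₁ P.1 ∧ ArchOut k (θ⁻¹ * μ) τ'.1 ψ₁ T ∧ PaneArchOut n k (θ⁻¹ * μ) P.1 χ) → MemberPkgCont F₀ π ι eψ K := by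
  intro hex hpin hpane F₀ F _ _ _ _ _ τ n hcpt π e k ℓ _ ι eψ hH hF K _ _ _ _ cK h2 hcK L F' _ _ _ _ _ _
    _ _ _ _ _ s hT θ hpar hobj
  obtain ⟨hTR, hdeg, hτ, -, -, -, -, -, -, -, -, hnti⟩ := id hH
  -- the rank is positive
  have hn : 0 < n := by
    obtain ⟨w, α, β, c, c', hα, hβ, -, -, hne⟩ := hnti.exists
    by_contra h0
    obtain rfl : n = 0 := Nat.eq_zero_of_not_pos h0
    exact hne (by rw [Multiset.card_eq_zero.mp hα.card_eq, Multiset.card_eq_zero.mp hβ.card_eq,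
      Multiset.map_zero, Multiset.map_zero])
  obtain ⟨hFL, hKL, hF'L, hs, hsK, hsF, hdisj, hpaneT⟩ := hT
  obtain ⟨hsplit, μK, μF, hμK, hμF, hμKF, hsgnK, hsgnF⟩ := hpar
  -- signs of `θ` and the complex type
  set d : InfinitePlace F₀ → ℂˣ := fun v ↦ θ.archComponent v (-1) with hd
  have hdsq : ∀ v, d v ^ 2 = 1 := fun v ↦ archComponent_neg_one_sq θ v
  set cx : InfinitePlace F₀ → Prop := fun v ↦ ∃ σ : L →+* ℂ,
    ¬ ComplexEmbedding.IsReal (σ.comp (algebraMap F L)) ∧ InfinitePlace.mk (σ.comp (algebraMap F₀ L)) = v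
    with hcx
  have hθinv : ∀ (μ : HeckeCharacter F₀) (v : InfinitePlace F₀),
      (θ⁻¹ * μ).archComponent v (-1) = (d v)⁻¹ * μ.archComponent v (-1) := fun μ v ↦ by
    rw [archComponent_mul_apply, archComponent_inv_apply]
  -- §A the pin for `μ = 1`: `d` is constant on the complex type
  obtain ⟨τ₁, ψ₁₁, P₁, T₁, χ₁, ⟨-, -, hP₁csd, -⟩, -, hχ₁, hpane₁⟩ := hobj 1 (muHyp_one F K)
  obtain ⟨κ, hκ⟩ := hex F' L s hF'L hs n _ P₁ hn hP₁csd
  have hcxval : ∀ v, cx v → ((d v : ℂˣ) : ℂ) = (((κ : ℤ) : ℂ) * (-1 : ℂ) ^ (-k))⁻¹ := by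
    rintro v ⟨σ, hσF, rfl⟩
    obtain ⟨hnodup, hcard, m, hm, hcoset⟩ := hpane₁ σ
    -- an exponent at the pane
    obtain ⟨a, ha⟩ : ∃ a, a ∈ χ₁ σ := Multiset.card_pos_iff_exists_mem.mp (hcard ▸ hn)
    obtain ⟨j, hj⟩ := hcoset a ha
    -- the pin with `r = (n-1)/2 + (m+k)/2`
    have hcoset' : ∀ b ∈ χ₁ σ, ∃ m' : ℤ, b = (m' : ℂ) + (((((n : ℝ) - 1) / 2 + ((m : ℝ) + k) / 2 : ℝ)) : ℂ) := by
      intro b hb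
      obtain ⟨j', hj'⟩ := hcoset b hb
      exact ⟨j', by rw [hj']; push_cast; ring⟩
    obtain ⟨j', hj'⟩ := hpin F' L s hF'L hs n _ P₁ κ χ₁ σ _ hn hP₁csd hκ hχ₁ (hpaneT σ hσF) hnodup hcoset' a ha
    have hpinned := neg_one_zpow_eq_of_pin (hj.symm.trans hj')
    -- `(θ⁻¹)_v(-1) = (-1)^m` and `(-1)^(m+k) = κ`
    have hm' : ((d (InfinitePlace.mk (σ.comp (algebraMap F₀ L))) : ℂˣ) : ℂ)⁻¹ = (-1 : ℂ) ^ m := by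
      rw [mul_one, archComponent_inv_apply, Units.val_inv_eq_inv_val] at hm
      exact hm
    have hkm : (-1 : ℂ) ^ m = ((κ : ℤ) : ℂ) * (-1 : ℂ) ^ (-k) := by
      rw [← hpinned, ← zpow_add₀ (by norm_num : (-1 : ℂ) ≠ 0), add_neg_cancel_right]
    rw [← hkm, ← hm', inv_inv]
  -- §B constancy on both types, and the switch
  have hcxc : ∀ v v', cx v → cx v' → d v = d v' := fun v v' hv hv' ↦
    Units.ext ((hcxval v hv).trans (hcxval v' hv').symm)
  have hspc : ∀ v v', ¬ cx v → ¬ cx v' → d v = d v' := by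
    intro v v' hv hv'
    obtain ⟨w, hw, rfl⟩ := exists_isReal_of_not_cx v hv
    obtain ⟨w', hw', rfl⟩ := exists_isReal_of_not_cx v' hv'
    exact hsplit w w' hw hw'
  obtain ⟨ε₀, c, hε₀, hsw⟩ : ∃ ε₀ c : ℂˣ, ε₀ ^ 2 = 1 ∧ ∀ v, (if cx v then ε₀ * d v else d v) = c := by
    by_cases hs' : ∃ v₀, ¬ cx v₀
    · obtain ⟨v₀, hv₀⟩ := hs'
      by_cases hc' : ∃ v₁, cx v₁
      · obtain ⟨v₁, hv₁⟩ := hc'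
        refine ⟨d v₀ * (d v₁)⁻¹, d v₀, ?_, fun v ↦ ?_⟩
        · rw [mul_pow, inv_pow, hdsq, hdsq, inv_one, one_mul]
        · split_ifs with h
          · rw [hcxc v v₁ h hv₁, inv_mul_cancel_right]
          · exact hspc v v₀ h hv₀
      · push Not at hc'
        exact ⟨1, d v₀, one_pow 2, fun v ↦ by rw [if_neg (hc' v)]; exact hspc v v₀ (hc' v) hv₀⟩
    · push Not at hs'
      obtain ⟨v₁⟩ : Nonempty (InfinitePlace F₀) := inferInstance
      exact ⟨1, d v₁, one_pow 2, fun v ↦ by rw [if_pos (hs' v), one_mul]; exact hcxc v v₁ (hs' v) (hs' v₁)⟩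
  -- §C the choice of `μ ∈ {1, μK, μF, μK μF}`
  set t : ℂˣ := (-1 : ℂˣ) ^ ((n : ℤ) + k) with ht
  have htval : ((t : ℂˣ) : ℂ) = (-1 : ℂ) ^ ((n : ℤ) + k) := by
    rw [ht, Units.val_zpow_eq_zpow_val, Units.val_neg, Units.val_one]
  have htsq : ((t : ℂˣ) : ℂ) ^ 2 = 1 := by
    rw [htval, ← zpow_natCast, ← zpow_mul, mul_comm, zpow_mul]
    norm_num
  have hcsq : ((c : ℂˣ) : ℂ) ^ 2 = 1 := by
    obtain ⟨v₁⟩ : Nonempty (InfinitePlace F₀) := inferInstance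
    rw [← Units.val_pow_eq_pow_val, ← hsw v₁]
    split_ifs
    · rw [mul_pow, hε₀, hdsq, one_mul, Units.val_one]
    · rw [hdsq, Units.val_one]
  set A : ℂˣ := t * c with hA
  have hAsq : A ^ 2 = 1 :=
    Units.ext (by rw [Units.val_pow_eq_pow_val, hA, Units.val_mul, mul_pow, htsq, hcsq, one_mul, Units.val_one])
  set μA : HeckeCharacter F₀ := if A = 1 then 1 else μK with hμAdef
  set μB : HeckeCharacter F₀ := if ε₀ = 1 then 1 else μF with hμBdef
  have hμA : ∀ v, μA.archComponent v (-1) = A := by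
    intro v
    by_cases h1 : A = 1
    · rw [hμAdef, if_pos h1, h1, HeckeCharacter.archComponent_one, MonoidHom.one_apply]
    · rcases units_eq_or_of_sq hAsq with h | h
      · exact absurd h h1
      · rw [hμAdef, if_neg h1, hsgnK v, h]
  have hμBcx : ∀ v, cx v → μB.archComponent v (-1) = ε₀ := by
    rintro v ⟨σ, hσF, rfl⟩
    by_cases h1 : ε₀ = 1
    · rw [hμBdef, if_pos h1, h1, HeckeCharacter.archComponent_one, MonoidHom.one_apply]
    · rcases units_eq_or_of_sq hε₀ with h | h
      · exact absurd h h1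
      rw [hμBdef, if_neg h1, h]
      have hw := hsgnF (InfinitePlace.mk (σ.comp (algebraMap F L)))
      rw [if_neg (not_isReal_mk_of_cx hσF), InfinitePlace.comap_mk, RingHom.comp_assoc,
        ← IsScalarTower.algebraMap_eq F₀ F L] at hw
      exact hw
  have hμBsp : ∀ v, ¬ cx v → μB.archComponent v (-1) = 1 := by
    intro v hv
    by_cases h1 : ε₀ = 1
    · rw [hμBdef, if_pos h1, HeckeCharacter.archComponent_one, MonoidHom.one_apply]
    · rw [hμBdef, if_neg h1]
      obtain ⟨w, hw, rfl⟩ := exists_isReal_of_not_cx v hv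
      rw [hsgnF w, if_pos hw]
  have hμ : MuHyp F K (μA * μB) := by
    by_cases h1 : A = 1 <;> by_cases h1' : ε₀ = 1 <;>
      simp only [hμAdef, hμBdef, h1, h1', ↓reduceIte, one_mul, mul_one]
    exacts [muHyp_one F K, hμF, hμK, hμKF]
  -- the sign identity at every real place
  have hkey : ∀ v : InfinitePlace F₀,
      (((θ⁻¹ * (μA * μB)).archComponent v (-1) : ℂˣ) : ℂ) = (-1 : ℂ) ^ ((n : ℤ) + k) := by
    intro v
    rw [← htval, hθinv, archComponent_mul_apply, hμA, Units.val_mul, Units.val_mul,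
      Units.val_inv_eq_inv_val, hA, Units.val_mul]
    have hv := hsw v
    have hdv : ((d v : ℂˣ) : ℂ) ^ 2 = 1 := by rw [← Units.val_pow_eq_pow_val, hdsq, Units.val_one]
    have hdv0 : ((d v : ℂˣ) : ℂ) ≠ 0 := Units.ne_zero _
    by_cases h : cx v
    · rw [if_pos h] at hv
      rw [hμBcx v h]
      have hv' : ((ε₀ : ℂˣ) : ℂ) * (d v : ℂ) = c := by rw [← Units.val_mul, hv]
      have he : ((ε₀ : ℂˣ) : ℂ) ^ 2 = 1 := by rw [← Units.val_pow_eq_pow_val, hε₀, Units.val_one]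
      rw [← hv']
      calc ((d v : ℂˣ) : ℂ)⁻¹ * ((t : ℂ) * (((ε₀ : ℂˣ) : ℂ) * (d v : ℂ)) * ((ε₀ : ℂˣ) : ℂ))
          = (t : ℂ) * (((ε₀ : ℂˣ) : ℂ) ^ 2) * (((d v : ℂˣ) : ℂ)⁻¹ * (d v : ℂ)) := by ring
        _ = (t : ℂ) := by rw [he, inv_mul_cancel₀ hdv0, mul_one, mul_one]
    · rw [if_neg h] at hv
      rw [hμBsp v h, ← hv, Units.val_one, mul_one]
      calc ((d v : ℂˣ) : ℂ)⁻¹ * ((t : ℂ) * (d v : ℂ))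
          = (t : ℂ) * (((d v : ℂˣ) : ℂ)⁻¹ * (d v : ℂ)) := by ring
        _ = (t : ℂ) := by rw [inv_mul_cancel₀ hdv0, mul_one]
  -- §D the member objects for this `μ`
  obtain ⟨τ', ψ₁, P, T, χ, ⟨hdict, hτcsd, hPcsd, hAI⟩, ⟨hinfty, hWR, hcrit⟩, hχP, hpaneP⟩ :=
    hobj (μA * μB) hμ
  obtain ⟨hCalg, hψalg⟩ := hcrit hkey
  -- §E a pane: an embedding of `L` over a complex place of `F`
  obtain ⟨w₁, hw₁⟩ : ∃ w : InfinitePlace F, ¬ w.IsReal := by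
    by_contra hall
    push Not at hall
    exact hF ⟨hall⟩
  haveI : Algebra.IsAlgebraic F L := Algebra.IsAlgebraic.of_finite F L
  set σ₁ : L →+* ℂ := ComplexEmbedding.lift L w₁.embedding with hσ₁
  have hσ₁F : ¬ ComplexEmbedding.IsReal (σ₁.comp (algebraMap F L)) := by
    rw [hσ₁, ComplexEmbedding.lift_comp_algebraMap]
    rwa [InfinitePlace.not_isReal_iff_isComplex, InfinitePlace.isComplex_iff] at hw₁
  obtain ⟨hnodup, hcard, m₁, hm₁, hcoset₁⟩ := hpaneP σ₁
  have hpar₁ : (-1 : ℂ) ^ m₁ = (-1 : ℂ) ^ ((n : ℤ) + k) := by rw [← hm₁, hkey]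
  have hhalf : ∀ a ∈ χ σ₁, ∃ i : ℤ, a = (i : ℂ) + 1 / 2 := fun a ha ↦ by
    obtain ⟨j, hj⟩ := hcoset₁ a ha
    exact exists_int_add_half_of_neg_one_zpow hpar₁ hj
  -- the pane law at the base `K⁺`
  have hsK' : ∀ x : K, s (algebraMap K L x) = algebraMap K L (IsCMField.complexConj K x) :=
    fun x ↦ by rw [complexConj_apply_eq hTR h2 hcK x]; exact hsK x
  have hτcsd' : τ'.1.IsConjSelfDualAE (IsCMField.complexConj K) :=
    isConjSelfDualAE_of_smul_eq (complexConj_smul_eq hTR h2 hcK) hτcsd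
  have hAsai : τ'.1.HasAsaiSignCont (IsCMField.complexConj K) 1 :=
    hpane (maximalRealSubfield K) K F' L (IsCMField.complexConj K) s
      (Algebra.IsQuadraticExtension.finrank_eq_two _ K) hKL hF'L (IsCMField.complexConj_ne_one K) hs
      hsK' n _ _ P τ' χ σ₁ hn hAI hPcsd hτcsd' hχP (hpaneT σ₁ hσ₁F) hnodup hcard hhalf
  exact ⟨_, τ', T, ψ₁, hinfty, hCalg, hWR, hτcsd', hAsai, hψalg, hdict⟩

end Main

end Summit.Langlands.Langlands.Theorems.HostInducedRep.OneTransparentPane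

end
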